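import Summits.Ventures.LatticeQCDFlow.Scoring.LagProductCLT

/-!
# The Gaussian limit of the empirical autocovariances EXISTS: `Σ_{m+W}` is symmetric positive semidefinite and `Z ~ N(0, Σ_{m+W})` realises it

HONEST FRAMING: exact (Metropolis-corrected) sampling algorithms for lattice gauge theory;
figures of merit are autocorrelation/cost numbers at stated couplings and volumes; no
continuum-physics claim.

Venture `LatticeQCDFlow` (cell pub-lqcd), sub-topic `Scoring`; FANOUT row 16 (`su2-base`), GEN-7.
NEW WORK of the cell over `Scoring/LagProductCLT`, row 4's `Scoring/MultivariateCLT`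
(`hasLaw_inner_of_isGaussian`) and Mathlib's `ProbabilityTheory.multivariateGaussian`; no definition;
nothing is cited as a fact.

Seventh file of the LAW-OF-THE-ERROR packet: NON-VACUITY.  The CLTs of `LagProductCLT` /
`MadrasSokalRatioCLT` are stated for an arbitrary random vector `Z` with prescribed Gaussian
projections `⟪a, Z⟫ ~ N(0, aᵀ Σ a)`.  This file proves such a `Z` exists for the `Σ` in question, so
the theorems are about an inhabited hypothesis: `Σ_{m+W}` is symmetric and positive semidefinite (its
quadratic form is a long-run variance, `BlockFactorSecondMoments.lrVar_nonneg`), and the identity on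
`(ℝ^{W+1}, multivariateGaussian 0 Σ)` has the required projections.

## Contents

* `dotProduct_mulVec_eq_sum`; **`hasLaw_inner_multivariateGaussian`** — for positive-semidefinite `M`,
  under `multivariateGaussian 0 M` the functional `z ↦ ⟪a, z⟫` has law `N(0, Σ_{s,t} a_s a_t M_{st})`.
* `lagProdACov_comm` (symmetry), **`quadForm_lagProdACov_nonneg`** (`aᵀ Σ_{m+W} a ≥ 0`),
  **`posSemidef_lagProdACov`** (`Matrix.of Σ_{m+W}` is `PosSemidef`).
* **`gaussianLimit_acovHat_realised`** — `Z = id` on `(ℝ^{W+1}, N(0, Σ_{m+W}))` satisfies the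
  hypotheses `hZm`, `hZ` of `tendstoInDistribution_acovHat`; **`tendstoInDistribution_acovHat_multivariateGaussian`**
  — the joint CLT with this concrete limit.

NOT CLAIMED: uniqueness in law of the limit (Cramér–Wold uniqueness is in Mathlib's
`Measure.ext_of_charFun`; not needed); `Σ` positive DEFINITE (false in general: `X` constant).
-/

noncomputable section

open MeasureTheory ProbabilityTheory Filter Finset WithLp Matrix
open scoped Topology NNReal RealInnerProductSpace

namespace Summit.Ventures.LatticeQCDFlow.Scoring

/-! ## Quadratic forms and `Matrix.of` -/

section Algebra

variable {n : ℕ}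

/-- `x ⬝ᵥ (M *ᵥ x) = Σ_s Σ_t x_s x_t M_{st}`. -/
theorem dotProduct_mulVec_eq_sum (M : Matrix (Fin n) (Fin n) ℝ) (x : Fin n → ℝ) :
    x ⬝ᵥ (M *ᵥ x) = ∑ s, ∑ t, x s * x t * M s t := by
  simp only [dotProduct, mulVec, mul_sum]
  exact sum_congr rfl fun s _ => sum_congr rfl fun t _ => by ring

end Algebra

/-! ## A centred multivariate Gaussian realises any symmetric positive-semidefinite covariance -/

section Realisation

variable {n : ℕ}

/-- **Realisation of the Gaussian limit.**  For a positive-semidefinite matrix `M`, the identity map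
on `(ℝ^n, N(0, M))` (Mathlib's `multivariateGaussian`) is a random vector `Z` with
`⟪a, Z⟫ ~ N(0, Σ_{s,t} a_s a_t M_{st})` for every `a` — exactly the hypothesis `hZ` of the joint CLT
`LagProductCLT.tendstoInDistribution_acovHat` and of `MadrasSokalRatioCLT`. -/
theorem hasLaw_inner_multivariateGaussian (M : Matrix (Fin n) (Fin n) ℝ) (hM : M.PosSemidef)
    (a : EuclideanSpace ℝ (Fin n)) :
    HasLaw (fun z : EuclideanSpace ℝ (Fin n) => ⟪a, z⟫)
      (gaussianReal 0 (∑ s, ∑ t, a s * a t * M s t).toNNReal) (multivariateGaussian 0 M) := by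
  have h := CardConsistency.hasLaw_inner_of_isGaussian (Z := id) (ν := multivariateGaussian 0 M)
    (P' := multivariateGaussian 0 M) HasLaw.id a
  have hmean : (multivariateGaussian 0 M)[fun x : EuclideanSpace ℝ (Fin n) => ⟪a, x⟫] = 0 := by
    have h1 := integral_inner (𝕜 := ℝ) (IsGaussian.integrable_id (μ := multivariateGaussian 0 M)) a
    simp only [id] at h1
    rw [h1, integral_id_multivariateGaussian, inner_zero_right]
  have hvar : Var[fun x : EuclideanSpace ℝ (Fin n) => ⟪a, x⟫; multivariateGaussian 0 M]
      = ∑ s, ∑ t, a s * a t * M s t := by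
    rw [← covarianceBilin_self IsGaussian.memLp_two_id, covarianceBilin_multivariateGaussian hM,
      dotProduct_mulVec_eq_sum]
  rw [hmean, hvar] at h
  exact h

end Realisation

/-! ## The asymptotic covariance matrix of a block-factor process is symmetric positive semidefinite -/

section PSD

variable {Ω : Type*} [MeasurableSpace Ω] {P : Measure Ω} [IsProbabilityMeasure P]
variable {S : Type*} [MeasurableSpace S] {ξ : ℕ → Ω → S} {m : ℕ} {F : (Fin (m + 1) → S) → ℝ}

omit [IsProbabilityMeasure P] in
/-- `Σ_K` is symmetric. -/
theorem lagProdACov_comm (X : ℕ → Ω → ℝ) (K s t : ℕ) :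
    lagProdACov X P K s t = lagProdACov X P K t s := by
  unfold lagProdACov
  have h0 : lagCov X P s t 0 = lagCov X P t s 0 := by
    simp only [lagCov, zero_add]
    exact covariance_comm _ _
  rw [h0]
  congr 1
  exact sum_congr rfl fun k _ => add_comm _ _

/-- **`Σ_{m+W}` is positive semidefinite** for a block-factor process with square-integrable lag
products: `aᵀ Σ a` is the long-run variance of the real block factor `⟪a, (X_iX_{i+t})_t⟫`
(`lrVar_inner_lagProdMap`), a limit of variances (`lrVar_nonneg`). -/
theorem quadForm_lagProdACov_nonneg (hξ : ∀ i, Measurable (ξ i)) (hind : iIndepFun ξ P)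
    (hid : ∀ i, IdentDistrib (ξ i) (ξ 0) P P) (hF : Measurable F)
    (h4 : ∀ t, MemLp (fun ω => blockFactor F ξ 0 ω * blockFactor F ξ t ω) 2 P) (W : ℕ)
    (a : EuclideanSpace ℝ (Fin (W + 1))) :
    0 ≤ ∑ s : Fin (W + 1), ∑ t : Fin (W + 1),
      a s * a t * lagProdACov (blockFactor F ξ) P (m + W) s t := by
  rw [← lrVar_inner_lagProdMap hind hid hF h4 W (m + W) a]
  have hm : Measurable fun w => ⟪a, lagProdMap F W w⟫ :=
    (continuous_const.inner continuous_id).measurable.comp (measurable_lagProdMap hF W)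
  exact lrVar_nonneg (m := m + W) hξ hind hid hm ((memLp_lagProdMap_window h4 W).const_inner a)

/-- **`Σ_{m+W}` as a positive-semidefinite matrix.** -/
theorem posSemidef_lagProdACov (hξ : ∀ i, Measurable (ξ i)) (hind : iIndepFun ξ P)
    (hid : ∀ i, IdentDistrib (ξ i) (ξ 0) P P) (hF : Measurable F)
    (h4 : ∀ t, MemLp (fun ω => blockFactor F ξ 0 ω * blockFactor F ξ t ω) 2 P) (W : ℕ) :
    (Matrix.of fun s t : Fin (W + 1) => lagProdACov (blockFactor F ξ) P (m + W) s t).PosSemidef := by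
  refine PosSemidef.of_dotProduct_mulVec_nonneg (IsHermitian.ext fun i j => ?_) fun x => ?_
  · simp only [of_apply, star_trivial]
    exact lagProdACov_comm _ _ _ _
  · rw [star_trivial, dotProduct_mulVec_eq_sum]
    simpa only [of_apply, PiLp.toLp_apply] using
      quadForm_lagProdACov_nonneg hξ hind hid hF h4 W (toLp 2 x)

/-- **THE GAUSSIAN LIMIT OF THE EMPIRICAL AUTOCOVARIANCES IS REALISED**: with
`Σ = lagProdACov X (m+W)` of a block-factor process, the random vector `Z = id` on
`(ℝ^{W+1}, N(0, Σ))` satisfies the hypotheses `hZm`, `hZ` of `tendstoInDistribution_acovHat` — the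
joint CLT, the `τ̂_W` CLT and the Wick-model law are statements about an object that exists. -/
theorem gaussianLimit_acovHat_realised (hξ : ∀ i, Measurable (ξ i)) (hind : iIndepFun ξ P)
    (hid : ∀ i, IdentDistrib (ξ i) (ξ 0) P P) (hF : Measurable F)
    (h4 : ∀ t, MemLp (fun ω => blockFactor F ξ 0 ω * blockFactor F ξ t ω) 2 P) (W : ℕ) :
    AEMeasurable (id : EuclideanSpace ℝ (Fin (W + 1)) → EuclideanSpace ℝ (Fin (W + 1)))
        (multivariateGaussian 0
          (Matrix.of fun s t : Fin (W + 1) => lagProdACov (blockFactor F ξ) P (m + W) s t))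
      ∧ ∀ a : EuclideanSpace ℝ (Fin (W + 1)), HasLaw (fun z : EuclideanSpace ℝ (Fin (W + 1)) => ⟪a, z⟫)
        (gaussianReal 0 (∑ s : Fin (W + 1), ∑ t : Fin (W + 1),
          a s * a t * lagProdACov (blockFactor F ξ) P (m + W) s t).toNNReal)
        (multivariateGaussian 0
          (Matrix.of fun s t : Fin (W + 1) => lagProdACov (blockFactor F ξ) P (m + W) s t)) := by
  refine ⟨aemeasurable_id, fun a => ?_⟩
  have h := hasLaw_inner_multivariateGaussian _ (posSemidef_lagProdACov hξ hind hid hF h4 W) a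
  simpa only [of_apply] using h

/-- Hence the joint CLT holds with THIS `Z`: `√N ((Γ̂_N(t))_t − (c(t))_t) ⇒ N(0, Σ_{m+W})`. -/
theorem tendstoInDistribution_acovHat_multivariateGaussian (hξ : ∀ i, Measurable (ξ i))
    (hind : iIndepFun ξ P) (hid : ∀ i, IdentDistrib (ξ i) (ξ 0) P P) (hF : Measurable F)
    (h4 : ∀ t, MemLp (fun ω => blockFactor F ξ 0 ω * blockFactor F ξ t ω) 2 P) (W : ℕ) :
    TendstoInDistribution
      (fun (N : ℕ) ω => Real.sqrt N • (toLp 2 (fun t : Fin (W + 1) => acovHat (blockFactor F ξ) N t ω)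
        - toLp 2 (fun t : Fin (W + 1) => P[fun ω => blockFactor F ξ 0 ω * blockFactor F ξ t ω])))
      atTop (id : EuclideanSpace ℝ (Fin (W + 1)) → EuclideanSpace ℝ (Fin (W + 1))) (fun _ => P)
      (multivariateGaussian 0
        (Matrix.of fun s t : Fin (W + 1) => lagProdACov (blockFactor F ξ) P (m + W) s t)) := by
  obtain ⟨hZm, hZ⟩ := gaussianLimit_acovHat_realised hξ hind hid hF h4 W
  exact tendstoInDistribution_acovHat hξ hind hid hF h4 W hZm hZ

end PSD

end Summit.Ventures.LatticeQCDFlow.Scoring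

end
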